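import Literature.Analysis.PDE.InverseSquareExteriorEnergyIdentity
import Literature.Analysis.PDE.DAlembert1D
import Literature.Analysis.PDE.Wave1DExteriorEnergy
import Literature.Analysis.Calculus.EnergyTailCutoff
import HarnessLib

/-!
# Model waves on the closed cone `{|t| ≤ x}` whose far energies at apex `0` carry the full energy

Analysis/PDE support file (everything proved, no definitions). Fix a smooth `ι = 1/x` on `[½, ∞)`
(with a smooth primitive), `n : ℕ`, and data `h ∈ C²`, `g ∈ C¹` supported in `[R₁, B]`,
`3 ≤ R₁ ≤ B`. There is a global `C²` function `φ` with Cauchy data `(h, g)` (on all of `ℝ`) which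
solves the model equation `φ_tt − φ_xx + n(n+1)ι²φ = 0` at every point of the CLOSED CONE
`{|t| ≤ x}` and whose far energies at apex `0` dominate the model energy of the data in the two
time directions together:

  `ofReal (∫_{R₁}^B h′² + n(n+1)ι²h² + g²)
      ≤ liminf_{t→+∞} ∫⁻_{x>|t|} e₀[φ](t) + liminf_{t→−∞} ∫⁻_{x>|t|} e₀[φ](t)`

(`inverseSquare_coneModelWave`, `n ≥ 1`; `free_coneModelWave`, `n = 0`). For `n ≥ 1`, `φ` is the
regular exact inverse-square wave of `InverseSquareExteriorEnergyIdentity.inverseSquare_exteriorEnergy_ge`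
(apex `a = 0`: `E ≤ L⁺(0) + L⁻(0)`), multiplied by a smooth cutoff `χ₁(x)` (`0` below `½`, `1`
above `1`): since the regular wave vanishes on `{½ < x, x + |t| < R₁}`, the cut wave vanishes on the
whole backward region `{x + |t| < R₁}` and agrees with the regular one on `x ≥ 1`, so it solves the
model equation at every cone point (`R₁ ≥ 3`) and has the same far energies for `|t| ≥ 1`. For
`n = 0` the d'Alembert wave `F(x−t) + G(x+t)` does it, the forward far energy catching the
right-mover `2∫F′²` and the backward one the left-mover `2∫G′²`. This is the model input of the
per-mode far-side half-share of crux `WindowedShellChannels` (route PhotonSphereChannels,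
stmt-FinalStateConjecture-14085, stub `stub_farHalfShare`), consumed through
`Wave1DFarModelComparison(TwoSided)`. Folklore.
-/

noncomputable section

namespace Literature.Analysis.PDE

open MeasureTheory Set Filter Topology intervalIntegral Real Literature.Analysis.Calculus
  Literature.Analysis.ODE
open scoped ENNReal

/-- A smooth cutoff equal to `0` on `(−∞, ½]` and to `1` on `[1, ∞)`. [folklore] -/
theorem exists_smooth_cutoff_half_one :
    ∃ χ : ℝ → ℝ, ContDiff ℝ (⊤ : ℕ∞) χ ∧ (∀ x, x ≤ 1 / 2 → χ x = 0) ∧ (∀ x, 1 ≤ x → χ x = 1) := by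
  obtain ⟨χ, hχC, hχ1, hχ2, -, -⟩ := exists_smooth_cutoff
  refine ⟨fun x => 1 - χ (2 * x), contDiff_const.sub (hχC.comp (contDiff_const.mul contDiff_id)),
    fun x hx => ?_, fun x hx => ?_⟩
  · simp only [hχ1 (2 * x) (by linarith), sub_self]
  · simp only [hχ2 (2 * x) (by linarith), sub_zero]

/-- `ofReal (∫ f) ≤ ∫⁻ ofReal ∘ f` for every real `f` on a restricted measure (both sides discard the
negative part; the left side is `0` for a non-integrable `f`). [folklore] -/
theorem ofReal_setIntegral_le_lintegral_ofReal (f : ℝ → ℝ) (s : Set ℝ) :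
    ENNReal.ofReal (∫ x in s, f x) ≤ ∫⁻ x in s, ENNReal.ofReal (f x) := by
  by_cases hf : IntegrableOn f s
  · calc ENNReal.ofReal (∫ x in s, f x) ≤ ENNReal.ofReal (∫ x in s, max (f x) 0) :=
          ENNReal.ofReal_le_ofReal (integral_mono hf hf.pos_part fun a => le_max_left _ _)
      _ = ∫⁻ x in s, ENNReal.ofReal (max (f x) 0) :=
          ofReal_integral_eq_lintegral_ofReal hf.pos_part
            (Eventually.of_forall fun a => le_max_right _ _)
      _ = ∫⁻ x in s, ENNReal.ofReal (f x) := lintegral_congr fun a => by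
          rcases le_total (f a) 0 with h | h
          · rw [max_eq_right h, ENNReal.ofReal_zero, ENNReal.ofReal_of_nonpos h]
          · rw [max_eq_left h]
  · rw [integral_undef hf, ENNReal.ofReal_zero]
    exact zero_le

/-- From a real limit to a lower bound of the `liminf` of dominating `[0,∞]`-valued functions.
[folklore] -/
theorem ofReal_le_liminf_of_tendsto {l : Filter ℝ} [l.NeBot] {I : ℝ → ℝ} {L : ℝ} {B : ℝ → ℝ≥0∞}
    (hI : Tendsto I l (𝓝 L)) (hB : ∀ᶠ t in l, ENNReal.ofReal (I t) ≤ B t) :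
    ENNReal.ofReal L ≤ liminf B l := by
  have h1 : Tendsto (fun t => ENNReal.ofReal (I t)) l (𝓝 (ENNReal.ofReal L)) :=
    (ENNReal.continuous_ofReal.tendsto L).comp hI
  rw [← h1.liminf_eq]
  exact liminf_le_liminf hB

variable {ι I : ℝ → ℝ}

/-- **The cut regular inverse-square wave on the closed cone** (`n ≥ 1`). See the module docstring.
[folklore] -/
theorem inverseSquare_coneModelWave (hι : ContDiff ℝ (⊤ : ℕ∞) ι)
    (hιeq : ∀ x : ℝ, 1 / 2 ≤ x → ι x = x⁻¹) (hI : ContDiff ℝ (⊤ : ℕ∞) I)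
    (hI' : ∀ x, HasDerivAt I (ι x) x) {n : ℕ} (hn : 1 ≤ n) {h g : ℝ → ℝ}
    (hh : ContDiff ℝ 2 h) (hg : ContDiff ℝ 1 g) {R₁ B : ℝ}
    (hR₁ : 3 ≤ R₁) (hR₁B : R₁ ≤ B) (hh0 : ∀ x, x ≤ R₁ → h x = 0) (hg0 : ∀ x, x ≤ R₁ → g x = 0)
    (hhB : ∀ x, B ≤ x → h x = 0) (hgB : ∀ x, B ≤ x → g x = 0) :
    ∃ φ : ℝ → ℝ → ℝ, ContDiff ℝ 2 (Function.uncurry φ) ∧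
      (∀ t x, |t| ≤ x → iteratedDeriv 2 (fun τ => φ τ x) t - iteratedDeriv 2 (φ t) x
        + (n : ℝ) * (n + 1) * ι x ^ 2 * φ t x = 0) ∧
      (∀ x, φ 0 x = h x) ∧ (∀ x, deriv (fun τ => φ τ x) 0 = g x) ∧
      ENNReal.ofReal (∫ x in R₁..B, deriv h x ^ 2 + n * (n + 1) * ι x ^ 2 * h x ^ 2 + g x ^ 2)
        ≤ liminf (fun t => ∫⁻ x in Ioi |t|, ENNReal.ofReal (deriv (fun τ => φ τ x) t ^ 2
            + deriv (φ t) x ^ 2 + (n : ℝ) * (n + 1) * ι x ^ 2 * φ t x ^ 2)) atTop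
          + liminf (fun t => ∫⁻ x in Ioi |t|, ENNReal.ofReal (deriv (fun τ => φ τ x) t ^ 2
            + deriv (φ t) x ^ 2 + (n : ℝ) * (n + 1) * ι x ^ 2 * φ t x ^ 2)) atBot := by
  obtain ⟨φ, hφC, hφsol, hd0, hd1, hsupp, hlim⟩ := inverseSquare_exteriorEnergy_ge hι hιeq hI hI' hn
    hh hg (by linarith) hR₁B hh0 hg0 hhB hgB
  obtain ⟨Lp, Lm, hLp, hLm, hE⟩ := hlim 0 le_rfl
  obtain ⟨χ, hχC, hχ0, hχ1⟩ := exists_smooth_cutoff_half_one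
  set Φ : ℝ → ℝ → ℝ := fun t x => χ x * φ t x with hΦ
  have hχC2 : ContDiff ℝ 2 χ := hχC.of_le (by norm_cast)
  have hΦC : ContDiff ℝ 2 (Function.uncurry Φ) := (hχC2.comp contDiff_snd).mul hφC
  -- `Φ` vanishes on the open backward region `{x + |t| < R₁}`
  have hvan : ∀ t x, x + |t| < R₁ → Φ t x = 0 := by
    intro t x hx
    simp only [hΦ]
    rcases le_or_gt x (1 / 2) with h1 | h1
    · rw [hχ0 x h1, zero_mul]
    · rw [hsupp t x h1 hx, mul_zero]
  -- `Φ = φ` beyond `x = 1`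
  have hΦφ : ∀ t x, 1 ≤ x → Φ t x = φ t x := fun t x hx => by simp only [hΦ, hχ1 x hx, one_mul]
  have hΦφ_t : ∀ x, 1 ≤ x → (fun τ => Φ τ x) = fun τ => φ τ x := fun x hx =>
    funext fun τ => hΦφ τ x hx
  have hΦφ_x : ∀ t x, 1 < x → Φ t =ᶠ[𝓝 x] φ t := by
    intro t x hx
    filter_upwards [Ioi_mem_nhds hx] with y hy using hΦφ t y (le_of_lt hy)
  refine ⟨Φ, hΦC, fun t x htx => ?_, fun x => ?_, fun x => ?_, ?_⟩
  · -- the equation at a cone point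
    by_cases hreg : x + |t| < R₁
    · -- `Φ` vanishes near `(t, x)`
      have ht' : (fun τ => Φ τ x) =ᶠ[𝓝 t] fun _ => (0 : ℝ) := by
        have ho : IsOpen {τ : ℝ | x + |τ| < R₁} := isOpen_lt (by fun_prop) continuous_const
        filter_upwards [ho.mem_nhds (by exact hreg)] with τ hτ using hvan τ x hτ
      have hx' : (Φ t) =ᶠ[𝓝 x] fun _ => (0 : ℝ) := by
        have ho : IsOpen {y : ℝ | y + |t| < R₁} := isOpen_lt (by fun_prop) continuous_const
        filter_upwards [ho.mem_nhds (by exact hreg)] with y hy using hvan t y hy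
      rw [ht'.iteratedDeriv_eq 2, hx'.iteratedDeriv_eq 2, hvan t x hreg]
      simp
    · rw [not_lt] at hreg
      have hx1 : 1 < x := by
        have := abs_nonneg t
        linarith
      rw [hΦφ_t x hx1.le, (hΦφ_x t x hx1).iteratedDeriv_eq 2, hΦφ t x hx1.le]
      have h := hφsol t x (by show (1:ℝ) / 2 < x; linarith)
      linarith
  · -- position datum
    show χ x * φ 0 x = h x
    rcases le_or_gt x (1 / 2) with h1 | h1
    · rw [hχ0 x h1, zero_mul, hh0 x (by linarith)]
    · rcases le_or_gt 1 x with h2 | h2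
      · rw [hχ1 x h2, one_mul, hd0 x h1]
      · rw [hd0 x h1, hh0 x (by linarith), mul_zero]
  · -- velocity datum
    show deriv (fun τ => χ x * φ τ x) 0 = g x
    rw [deriv_const_mul_field]
    rcases le_or_gt x (1 / 2) with h1 | h1
    · rw [hχ0 x h1, zero_mul, hg0 x (by linarith)]
    · rcases le_or_gt 1 x with h2 | h2
      · rw [hχ1 x h2, one_mul, hd1 x h1]
      · rw [hd1 x h1, hg0 x (by linarith), mul_zero]
  · -- the far energies
    have hfwd : ENNReal.ofReal Lp ≤ liminf (fun t => ∫⁻ x in Ioi |t|, ENNReal.ofReal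
        (deriv (fun τ => Φ τ x) t ^ 2 + deriv (Φ t) x ^ 2
          + (n : ℝ) * (n + 1) * ι x ^ 2 * Φ t x ^ 2)) atTop := by
      refine ofReal_le_liminf_of_tendsto hLp ?_
      filter_upwards [eventually_ge_atTop (1 : ℝ)] with t ht
      rw [abs_of_nonneg (by linarith), show (0 : ℝ) + t = t by ring]
      refine (ofReal_setIntegral_le_lintegral_ofReal _ _).trans (le_of_eq ?_)
      refine setLIntegral_congr_fun measurableSet_Ioi fun x hx => ?_
      have hx1 : 1 < x := lt_of_le_of_lt ht hx
      rw [hΦφ_t x hx1.le, (hΦφ_x t x hx1).deriv_eq, hΦφ t x hx1.le]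
    have hbwd : ENNReal.ofReal Lm ≤ liminf (fun t => ∫⁻ x in Ioi |t|, ENNReal.ofReal
        (deriv (fun τ => Φ τ x) t ^ 2 + deriv (Φ t) x ^ 2
          + (n : ℝ) * (n + 1) * ι x ^ 2 * Φ t x ^ 2)) atBot := by
      refine ofReal_le_liminf_of_tendsto hLm ?_
      filter_upwards [eventually_le_atBot (-1 : ℝ)] with t ht
      rw [abs_of_nonpos (by linarith), show (0 : ℝ) - t = -t by ring]
      refine (ofReal_setIntegral_le_lintegral_ofReal _ _).trans (le_of_eq ?_)
      refine setLIntegral_congr_fun measurableSet_Ioi fun x hx => ?_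
      have hx1 : 1 < x := by have : (-t : ℝ) < x := hx; linarith
      rw [hΦφ_t x hx1.le, (hΦφ_x t x hx1).deriv_eq, hΦφ t x hx1.le]
    calc ENNReal.ofReal (∫ x in R₁..B, deriv h x ^ 2 + n * (n + 1) * ι x ^ 2 * h x ^ 2 + g x ^ 2)
        ≤ ENNReal.ofReal (Lp + Lm) := ENNReal.ofReal_le_ofReal hE
      _ ≤ ENNReal.ofReal Lp + ENNReal.ofReal Lm := ENNReal.ofReal_add_le
      _ ≤ _ := add_le_add hfwd hbwd

/-- **The free wave on the closed cone** (`n = 0`): for `h ∈ C²`, `g ∈ C¹` supported in `[R₁, B]`,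
`0 ≤ R₁ ≤ B`, d'Alembert's wave has data `(h, g)`, solves `φ_tt = φ_xx` everywhere, and its far
energies at apex `0` in the two time directions together carry the free energy `∫ h′² + g²`
(forward the right-mover, backward the left-mover). [folklore] -/
theorem free_coneModelWave {h g : ℝ → ℝ} (hh : ContDiff ℝ 2 h) (hg : ContDiff ℝ 1 g) {R₁ B : ℝ}
    (hR₁ : 0 ≤ R₁) (hR₁B : R₁ ≤ B) :
    ∃ φ : ℝ → ℝ → ℝ, ContDiff ℝ 2 (Function.uncurry φ) ∧
      (∀ t x, iteratedDeriv 2 (fun τ => φ τ x) t - iteratedDeriv 2 (φ t) x = 0) ∧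
      (∀ x, φ 0 x = h x) ∧ (∀ x, deriv (fun τ => φ τ x) 0 = g x) ∧
      ENNReal.ofReal (∫ x in R₁..B, deriv h x ^ 2 + g x ^ 2)
        ≤ liminf (fun t => ∫⁻ x in Ioi |t|, ENNReal.ofReal (deriv (fun τ => φ τ x) t ^ 2
            + deriv (φ t) x ^ 2)) atTop
          + liminf (fun t => ∫⁻ x in Ioi |t|, ENNReal.ofReal (deriv (fun τ => φ τ x) t ^ 2
            + deriv (φ t) x ^ 2)) atBot := by
  obtain ⟨φ, F, G, hφC, hFC, hGC, -, -, -, -, hsplit, hwave, hd0, hd1, -, -, he⟩ :=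
    exists_dAlembert_solution hh hg
  have hFc : Continuous fun y => deriv F y ^ 2 := (hFC.continuous_deriv (by norm_num)).pow 2
  have hGc : Continuous fun y => deriv G y ^ 2 := (hGC.continuous_deriv (by norm_num)).pow 2
  have hec : ∀ t, Continuous fun x => deriv (fun τ => φ τ x) t ^ 2 + deriv (φ t) x ^ 2 := by
    intro t
    have : (fun x => deriv (fun τ => φ τ x) t ^ 2 + deriv (φ t) x ^ 2)
        = fun x => 2 * deriv F (x - t) ^ 2 + 2 * deriv G (x + t) ^ 2 := funext fun x => he t x
    rw [this]
    have hF' : Continuous (deriv F) := hFC.continuous_deriv (by norm_num)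
    have hG' : Continuous (deriv G) := hGC.continuous_deriv (by norm_num)
    exact ((hF'.comp (continuous_id.sub continuous_const)).pow 2 |>.const_mul 2).add
      ((hG'.comp (continuous_id.add continuous_const)).pow 2 |>.const_mul 2)
  have he0 : ∀ t x, 0 ≤ deriv (fun τ => φ τ x) t ^ 2 + deriv (φ t) x ^ 2 := fun t x => by
    positivity
  -- interval energies are dominated by the half-line lower integrals
  have hkey : ∀ t u v : ℝ, u ≤ v → ENNReal.ofReal (∫ x in u..v,
      (deriv (fun τ => φ τ x) t ^ 2 + deriv (φ t) x ^ 2))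
      ≤ ∫⁻ x in Ioi u, ENNReal.ofReal (deriv (fun τ => φ τ x) t ^ 2 + deriv (φ t) x ^ 2) := by
    intro t u v huv
    rw [integral_of_le huv, ofReal_integral_eq_lintegral_ofReal (hec t).integrableOn_Ioc
      (ae_restrict_of_forall_mem measurableSet_Ioc fun x _ => he0 t x)]
    exact lintegral_mono_set Ioc_subset_Ioi_self
  have hfwd : ENNReal.ofReal (2 * ∫ y in (0:ℝ)..B, deriv F y ^ 2)
      ≤ liminf (fun t => ∫⁻ x in Ioi |t|, ENNReal.ofReal (deriv (fun τ => φ τ x) t ^ 2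
            + deriv (φ t) x ^ 2)) atTop := by
    refine le_liminf_of_le (by isBoundedDefault) ?_
    filter_upwards [eventually_ge_atTop (0 : ℝ)] with t ht
    rw [abs_of_nonneg ht]
    have hB0 : 0 ≤ B := hR₁.trans hR₁B
    have h1 := dAlembert_intervalEnergy_ge_right_mover hGC hFC he t (u := t) (v := t + B)
      (by linarith)
    rw [sub_self, add_sub_cancel_left] at h1
    exact (ENNReal.ofReal_le_ofReal h1).trans (hkey t t (t + B) (by linarith))
  have hbwd : ENNReal.ofReal (2 * ∫ y in (0:ℝ)..B, deriv G y ^ 2)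
      ≤ liminf (fun t => ∫⁻ x in Ioi |t|, ENNReal.ofReal (deriv (fun τ => φ τ x) t ^ 2
            + deriv (φ t) x ^ 2)) atBot := by
    refine le_liminf_of_le (by isBoundedDefault) ?_
    filter_upwards [eventually_le_atBot (0 : ℝ)] with t ht
    rw [abs_of_nonpos ht]
    have hB0 : 0 ≤ B := hR₁.trans hR₁B
    have h1 := dAlembert_intervalEnergy_ge_left_mover hGC hFC he t (u := -t) (v := -t + B)
      (by linarith)
    rw [neg_add_cancel, show -t + B + t = B by ring] at h1
    exact (ENNReal.ofReal_le_ofReal h1).trans (hkey t (-t) (-t + B) (by linarith))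
  refine ⟨φ, hφC, fun t x => by rw [hwave t x]; ring, hd0, hd1, ?_⟩
  -- `∫_{R₁}^B h'² + g² = ∫_{R₁}^B 2F'² + 2G'² ≤ 2∫_0^B F'² + 2∫_0^B G'²`
  have hB0 : 0 ≤ B := hR₁.trans hR₁B
  have e1 : (∫ x in R₁..B, deriv h x ^ 2 + g x ^ 2)
      = ∫ x in R₁..B, (2 * deriv F x ^ 2 + 2 * deriv G x ^ 2) :=
    integral_congr fun x _ => (hsplit x).symm
  have e2 : (∫ x in R₁..B, (2 * deriv F x ^ 2 + 2 * deriv G x ^ 2))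
      ≤ ∫ x in (0:ℝ)..B, (2 * deriv F x ^ 2 + 2 * deriv G x ^ 2) :=
    integral_mono_interval hR₁ hR₁B le_rfl
      (Eventually.of_forall fun x => by positivity) ((hFc.const_mul 2).add (hGc.const_mul 2)
        |>.intervalIntegrable _ _)
  have e3 : (∫ x in (0:ℝ)..B, (2 * deriv F x ^ 2 + 2 * deriv G x ^ 2))
      = 2 * (∫ x in (0:ℝ)..B, deriv F x ^ 2) + 2 * ∫ x in (0:ℝ)..B, deriv G x ^ 2 := by
    rw [integral_add ((hFc.const_mul 2).intervalIntegrable _ _)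
      ((hGc.const_mul 2).intervalIntegrable _ _), intervalIntegral.integral_const_mul,
      intervalIntegral.integral_const_mul]
  have hF0 : 0 ≤ 2 * ∫ x in (0:ℝ)..B, deriv F x ^ 2 :=
    mul_nonneg (by norm_num) (integral_nonneg hB0 fun x _ => sq_nonneg _)
  have hG0 : 0 ≤ 2 * ∫ x in (0:ℝ)..B, deriv G x ^ 2 :=
    mul_nonneg (by norm_num) (integral_nonneg hB0 fun x _ => sq_nonneg _)
  calc ENNReal.ofReal (∫ x in R₁..B, deriv h x ^ 2 + g x ^ 2)
      ≤ ENNReal.ofReal (2 * (∫ x in (0:ℝ)..B, deriv F x ^ 2) + 2 * ∫ x in (0:ℝ)..B, deriv G x ^ 2) := by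
        rw [e1, ← e3]; exact ENNReal.ofReal_le_ofReal e2
    _ = ENNReal.ofReal (2 * ∫ x in (0:ℝ)..B, deriv F x ^ 2)
        + ENNReal.ofReal (2 * ∫ x in (0:ℝ)..B, deriv G x ^ 2) := ENNReal.ofReal_add hF0 hG0
    _ ≤ _ := add_le_add hfwd hbwd

end Literature.Analysis.PDE
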